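import Summits.BirchSwinnertonDyer.BirchSwinnertonDyer.Theorems.AdditiveBranchIMCGordTwoRankOneHeegnerKolyvaginManinFree
import Summits.BirchSwinnertonDyer.BirchSwinnertonDyer.Theses.AdditiveBranchIMC
import HarnessLib

/-!
# Route `AdditiveBranchIMC` (rung K1), crux `GordTwoRankOne` (item 19358): the Heegner–Kolyvagin road,
# Part 8 — the typed input in its BSD-CONSISTENT normalisation (Manin- and Tamagawa-ADJUSTED index
# bound), and the class-level theorem / crux BY NAME restated on it
# (cell `bsd-addord`, second prover lane `bsd-addord-k1-c3x`, gen 0; `--supports` only)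

HONEST FRAMING. THEOREMS ONLY: no definition, no new named fact, no `sorry`; nothing is booked; the crux
stays OPEN at class level. SELF-CORRECTION of Parts 5 and 3 (same lane, same day): there the typed input
`hL` asks x11b's `X11b.IndexLowerBoundAt W p K P` — `2·ord_p[E(K):ℤP] ≤ ord_p #Ш(E/K) + 2·ord_p ∏c_ℓ(E)` —
at EVERY parametrisation datum `Dt`, with NO Manin condition. That hypothesis is TOO STRONG to be an open
problem: the tree's parametrisation data admit any non-zero integer multiplier (a datum with constant `c`
yields one with constant `p^k·c`, whose Heegner point is `p^k·P` and whose index is `p^k` times larger), so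
for `k ≫ 0` the inequality fails — the `∀ Dt` form of `hL` in Parts 5/3 is (for every pair with `Ш(E/K)`
finite and `P` of infinite order) unsatisfiable, and those two theorems, though correct, are idle. Likewise,
even at a Manin-good datum, by the exact identity of Part 4 and BSD for `E` and `E^{d_K}` one has
`2·ord_p[E(K):ℤP] = ord_p #Ш(E/K) + ord_p ∏c(E) + ord_p ∏c(E^{d_K}) + 2·ord_p c(Dt)`, so x11b's
normalisation is BSD-consistent exactly when `ord_p ∏c(E^{d_K}) = ord_p ∏c(E)` (automatic at `p ≥ 5`,
x11b's `padicValNat_tamagawaProduct_twist_of_heegner`; at `p = 3` it can fail when `2 ∣ d_K`). THIS FILE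
states the road's input in the normalisation that BSD itself predicts WITH EQUALITY at every datum, every
Heegner field and every odd `p` — the ADJUSTED index bound
  `2·ord_p[E(K):ℤP] ≤ ord_p #Ш(E/K) + ord_p ∏c_ℓ(E) + ord_p ∏c_ℓ(Wd) + 2·ord_p c(Dt)`
(`Wd` a globally minimal model of `E^{d_K}`) — and re-derives everything from it: the class-free lower half
(`missingLowerBoundAt_of_adjustedIndexBound`, which needs NEITHER the Tamagawa transport NOR a Manin datum:
`v(q) = 2v(I) − v(q_d) − v(c_E) − 2v(t_d) − 2v(c) ≤ v(Ш_E) + v(Ш_d) + v(c_d) − v(q_d) − 2v(t_d) ≤ v(Ш_E)`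
by Kato's `v(Ш_d) + v(c_d) − 2v(t_d) ≤ v(q_d)`), the pointwise door at an additive potentially good prime,
the class-level theorem on the tower-surjective rows, and the crux BY NAME. x11b's `IndexLowerBoundAt`
IMPLIES the adjusted bound at the same datum (`adjustedIndexBound_of_indexLowerBoundAt`, by Part 1's ALL-`p`
inequality and `ord_p c ≥ 0`), so these theorems have WEAKER hypotheses than Parts 2/5/3; and a McCallum
any-level certificate supplies the adjusted bound as before. The adjusted bound at a pair is implied by
`BSD(E,p) ∧ BSD(E^{d_K},p)` (with equality), so as a `∀`-statement over the cell it is a genuine open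
problem (Kolyvagin–Zhang / anticyclotomic IMC at an additive prime), not a refutable one.

References: [JetchevSkinnerWan2017] §7.4.1; [GrossZagier1986] V.§2, Conj. (V.2.2); [McCallumLMS1991] §1,
Lemma 5.1; [Kato2004Asterisque] Thm 14.5 (3); [Miller2011LMS] Def 1.1.
-/

set_option autoImplicit false
set_option linter.dupNamespace false
noncomputable section

open scoped Classical NumberField
open WeierstrassCurve NumberField IsDedekindDomain
  Literature.NumberTheory.EllipticCurves Literature.NumberTheory.EllipticCurves.ModularForms
  Literature.NumberTheory.EllipticCurves.Rank1Residual
  Literature.NumberTheory.EllipticCurves.Rank1Residual.Typed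
  Summit.BirchSwinnertonDyer.Rank1Residual
  Summit.BirchSwinnertonDyer.Rank1Residual.Additive
  Summit.BirchSwinnertonDyer.Rank1Residual.X11b
  Summit.BirchSwinnertonDyer.Rank1Residual.GaloisImage
  Literature.NumberTheory.Automorphic

namespace Summit.BirchSwinnertonDyer.BirchSwinnertonDyer.Theorems.AdditiveBranchIMCGordTwoRankOne.HeegnerKolyvagin

/-! ### §14 The adjusted index bound: class-free lower half, and comparison with x11b's normalisation -/

/-- **The main-conjecture half from the ADJUSTED index bound — class-free, ANY reduction at `p`, NO Manin
datum, NO Tamagawa transport.** Data as in x11b's halves (`W/ℚ` globally minimal of conductor `N`,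
`ord_{s=1} L(E,s) = 1`; `K` imaginary quadratic, Heegner for `N`, `p ∤ #𝓞_K^×`, `L(E^{d_K},1) ≠ 0`; `P` the
Heegner point of ANY datum `Dt`; `Wd = Cd • W^{(d_K)}` globally minimal with `ord_p u(Cd) = 0`; the twist's
`≤`-half `htw` in Kato's shape); PUBLISHED binders `hGZ`, `hKo`, `hGZK`, `hmod`. TYPED INPUT:
`hL' : 2·ord_p[E(K):ℤP] ≤ ord_p #Ш(E/K) + ord_p ∏c_ℓ(E) + ord_p ∏c_ℓ(Wd) + 2·ord_p c(Dt)` (granted finiteness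
of `Ш(E/K)`) — the normalisation BSD predicts with equality. CONCLUSION: `Typed.MissingLowerBoundAt W p`.
Arithmetic (Part 4's identity): `v(q) = 2v(I) − v(q_d) − v(c_E) − 2v(t_d) − 2v(c) ≤ v(Ш_E) + v(Ш_d) +
v(c_d) − v(q_d) − 2v(t_d) ≤ v(Ш_E)`. [cite: JetchevSkinnerWan2017, §7.4.1 (pp. 30–31)]
[cite: GrossZagier1986, V.§2 and Conj. (V.2.2)] [cite: Miller2011LMS, Def. 1.1] -/
theorem missingLowerBoundAt_of_adjustedIndexBound
    (W : WeierstrassCurve ℚ) [W.IsElliptic] [W.IsGloballyMinimal] (p : ℕ) [Fact p.Prime]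
    (N : ℕ) [NeZero N] (K : Type) [Field K] [NumberField K]
    (Dt : ModularParametrizationData W N) (H : HeegnerDatum N (NumberField.discr K)) (ι : K →+* ℂ)
    (P : (W.baseChange K).toAffine.Point)
    (hGZ : gross_zagier N W K) (hKo : kolyvagin N W K)
    (hGZK : rank_eq_analyticRank_of_analyticRank_le_one) (hmod : hasEntireLFunction_rat)
    (hK : IsImaginaryQuadratic K) (hHN : SatisfiesHeegnerHypothesis N K)
    (hP : WeierstrassCurve.Affine.Point.map ι.toRatAlgHom P = heegnerPointComplex Dt H)
    (hp2 : p ≠ 2) (hμ : ¬ p ∣ Units.torsionOrder K)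
    (hr : W.analyticRank = 1)
    (hLt : (W.quadraticTwist (NumberField.discr K : ℚ)).entireLFunction 1 ≠ 0)
    (Wd : WeierstrassCurve ℚ) [Wd.IsElliptic] [Wd.IsGloballyMinimal] (Cd : VariableChange ℚ)
    (hWd : Cd • W.quadraticTwist (NumberField.discr K : ℚ) = Wd)
    (hu : padicValRat p (Cd.u : ℚ) = 0)
    (htw : ∃ q : ℚ, Wd.entireLFunction 1 / (Wd.realPeriodRat : ℂ) = (q : ℂ) ∧
      (padicValNat p Wd.shaOrder : ℤ) + padicValNat p Wd.tamagawaProduct -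
        2 * padicValNat p Wd.torsionOrder ≤ padicValRat p q)
    (hL' : Finite (W.baseChange K).sha →
      (2 * padicValNat p (AddSubgroup.zmultiples P).index : ℤ) ≤
        padicValNat p (W.baseChange K).shaOrder + padicValNat p W.tamagawaProduct +
          padicValNat p Wd.tamagawaProduct + 2 * padicValRat p (Dt.c : ℚ)) :
    Typed.MissingLowerBoundAt W p := by
  obtain ⟨qd, hqd, hvqd⟩ := htw
  obtain ⟨-, hfinK, hsha, q, hq, hval⟩ := exists_shaAn_padicVal_eq_of_heegner_maninKept W p N K Dt H ι P
    hGZ hKo hGZK hmod hK hHN hP hp2 hμ hr hLt Wd Cd hWd hu qd hqd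
  have e1 := hL' hfinK
  refine ⟨q, hq, ?_⟩
  have e2 : (padicValNat p (W.baseChange K).shaOrder : ℤ) =
      padicValNat p W.shaOrder + padicValNat p Wd.shaOrder := by exact_mod_cast hsha
  linarith

/-- **x11b's normalisation implies the adjusted bound at the same datum** (so every theorem below has a
WEAKER hypothesis than its Part 2 / Part 5 / Part 3 namesake): `X11b.IndexLowerBoundAt W p K P` gives the
adjusted bound, by Part 1's ALL-`p` inequality `ord_p ∏c(E) ≤ ord_p ∏c(Wd)` and `ord_p c(Dt) ≥ 0`
(`c ∈ ℤ`). In particular a McCallum any-level certificate (Part 2 `indexLowerBoundAt_of_anyLevelCertificate`)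
supplies the adjusted bound per pair. [cite: JetchevSkinnerWan2017, §7.4.1 (eq:shalowerK-1), p. 30] -/
theorem adjustedIndexBound_of_indexLowerBoundAt
    (W : WeierstrassCurve ℚ) [W.IsElliptic] (p : ℕ) [Fact p.Prime] (K : Type) [Field K] [NumberField K]
    (hK : IsImaginaryQuadratic K) (hH : SatisfiesHeegnerHypothesis (W.conductorNorm ℤ) K)
    {N : ℕ} [NeZero N] (Dt : ModularParametrizationData W N) (P : (W.baseChange K).toAffine.Point)
    {Wd : WeierstrassCurve ℚ} [Wd.IsElliptic] (Cd : VariableChange ℚ)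
    (hWd : Cd • W.quadraticTwist (NumberField.discr K : ℚ) = Wd) (hL : IndexLowerBoundAt W p K P) :
    (2 * padicValNat p (AddSubgroup.zmultiples P).index : ℤ) ≤
      padicValNat p (W.baseChange K).shaOrder + padicValNat p W.tamagawaProduct +
        padicValNat p Wd.tamagawaProduct + 2 * padicValRat p (Dt.c : ℚ) := by
  unfold IndexLowerBoundAt at hL
  have e1 : (2 * padicValNat p (AddSubgroup.zmultiples P).index : ℤ) ≤
      padicValNat p (W.baseChange K).shaOrder + 2 * padicValNat p W.tamagawaProduct := by
    exact_mod_cast hL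
  have e2 : (padicValNat p W.tamagawaProduct : ℤ) ≤ padicValNat p Wd.tamagawaProduct := by
    exact_mod_cast padicValNat_tamagawaProduct_le_twist_of_heegner W p K hK hH Cd hWd
  have e3 : (0 : ℤ) ≤ padicValRat p (Dt.c : ℚ) := by rw [padicValRat.of_int]; positivity
  linarith

/-! ### §15 The pointwise door and the class-level theorem on the adjusted bound -/

/-- **THE POINTWISE LOWER HALF at an additive potentially good prime from the ADJUSTED index bound — no
Manin datum, no Tamagawa transport, every odd `p`.** As Part 5's
`missingLowerBoundAt_rankOne_additive_of_indexLowerBoundAt_maninFree` with `hL` (x11b normalisation)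
replaced by the adjusted bound `hL'` at the datum and the chosen minimal twist model. PUBLISHED binders `hGZ`,
`hKo`, `hKatoT` (Kato 14.5 (3) Tamagawa-exact for the twist, additive potentially good at `p` by Part 1),
`hGZK`, `hmod`. [cite: JetchevSkinnerWan2017, §7.4.1 (pp. 29–31)] [cite: Kato2004Asterisque, Thm. 14.5 (3) (p. 236)] -/
theorem missingLowerBoundAt_rankOne_additive_of_adjustedIndexBound
    (W : WeierstrassCurve ℚ) [W.IsElliptic] [W.IsGloballyMinimal] (p : ℕ) [Fact p.Prime]
    [NeZero (W.conductorNorm ℤ)] (K : Type) [Field K] [NumberField K]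
    (Dt : ModularParametrizationData W (W.conductorNorm ℤ))
    (H : HeegnerDatum (W.conductorNorm ℤ) (NumberField.discr K)) (ι : K →+* ℂ)
    (P : (W.baseChange K).toAffine.Point)
    (hGZ : gross_zagier (W.conductorNorm ℤ) W K) (hKo : kolyvagin (W.conductorNorm ℤ) W K)
    (hKatoT : Kato2004.rankZero_padicValNat_sha_add_padicValNat_tamagawa_le_of_additive_potGood_of_imageContainsSL2)
    (hGZK : rank_eq_analyticRank_of_analyticRank_le_one) (hmod : hasEntireLFunction_rat)
    (hr : W.analyticRank = 1) (hp2 : p ≠ 2) (hadd : Addv W p) (hj : 0 ≤ padicValRat p W.j)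
    (hsurj : ∀ n : ℕ, W.HasSurjectiveModNGaloisRep (p ^ n : ℕ))
    (hK : IsImaginaryQuadratic K) (hHN : SatisfiesHeegnerHypothesis (W.conductorNorm ℤ) K)
    (hP : WeierstrassCurve.Affine.Point.map ι.toRatAlgHom P = heegnerPointComplex Dt H)
    (hμ : ¬ p ∣ Units.torsionOrder K)
    (hLt : (W.quadraticTwist (NumberField.discr K : ℚ)).entireLFunction 1 ≠ 0)
    (Wd : WeierstrassCurve ℚ) [Wd.IsElliptic] [Wd.IsGloballyMinimal] (Cd : VariableChange ℚ)
    (hWd : Cd • W.quadraticTwist (NumberField.discr K : ℚ) = Wd)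
    (hL' : Finite (W.baseChange K).sha →
      (2 * padicValNat p (AddSubgroup.zmultiples P).index : ℤ) ≤
        padicValNat p (W.baseChange K).shaOrder + padicValNat p W.tamagawaProduct +
          padicValNat p Wd.tamagawaProduct + 2 * padicValRat p (Dt.c : ℚ)) :
    Typed.MissingLowerBoundAt W p := by
  have hD0 : (NumberField.discr K : ℚ) ≠ 0 := by exact_mod_cast NumberField.discr_ne_zero K
  haveI hEt : (W.quadraticTwist (NumberField.discr K : ℚ)).IsElliptic := W.isElliptic_quadraticTwist hD0
  have haddd : Addv Wd p := addv_twist_of_heegner W p K hK hHN hadd Cd hWd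
  have hjd : 0 ≤ padicValRat p Wd.j := by
    have hjeq : Wd.j = W.j := by subst hWd; rw [variableChange_j, W.j_quadraticTwist hD0]
    rw [hjeq]; exact hj
  have hsurjd : ∀ n : ℕ, Wd.HasSurjectiveModNGaloisRep (p ^ n : ℕ) := fun n ↦
    (hasSurjectiveModNGaloisRep_pow_iff_of_model_twist W p hD0 ⟨Cd, hWd⟩ n).mpr (hsurj n)
  have hu : padicValRat p (Cd.u : ℚ) = 0 :=
    padicValRat_u_eq_zero_of_twist_minimal' W p K hK hHN hadd.1 Cd hWd
  have hLt' : (W.quadraticTwist (NumberField.discr K : ℚ)).entireLFunction = Wd.entireLFunction := by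
    rw [← hWd, entireLFunction_smul]
  have hLd1 : Wd.entireLFunction 1 ≠ 0 := by rw [← hLt']; exact hLt
  have htw := twist_le_half_of_katoTamagawaExact hKatoT hGZK hmod Wd p hp2 haddd hjd hsurjd hLd1
  exact missingLowerBoundAt_of_adjustedIndexBound W p (W.conductorNorm ℤ) K Dt H ι P hGZ hKo hGZK hmod hK hHN
    hP hp2 hμ hr hLt Wd Cd hWd hu htw hL'

/-- **Crux `GordTwoRankOne` (item 19358) on every tower-surjective pair of cell (G-ord, `e = 2`), from
PUBLISHED facts and the ADJUSTED index bound — the road's typed input in its BSD-consistent form.**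
PUBLISHED binders: `hGZ`, `hKo`, `hKatoT`, `hGZK`, `hmod`, `hnf` (root number), `hmodP` (a parametrisation at
the conductor level), `hFH` (Friedberg–Hoffstein), plus the tree's Heegner-datum existence theorems and
Néron's minimal model. TYPED INPUT `hL'` (OPEN at an additive prime; implied with equality by
`BSD(E,p) ∧ BSD(E^{d_K},p)`; in Kolyvagin's language `M_∞ ≤ ½(ord_p ∏c(E) + ord_p ∏c(E^{d_K})) + ord_p c`,
W. Zhang's refined conjecture; in Iwasawa language anticyclotomic IMC divisibility + BDP formula): for every
globally minimal rank-one `E` on the cell with `ρ̄_{E,p^n}` onto for all `n`, every Heegner field `K` of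
the conductor, every datum `Dt`, Heegner datum `H`, embedding `ι`, Heegner point `P ∈ E(K)` and every
globally minimal model `Wd` of `E^{d_K}`: `2·ord_p[E(K):ℤP] ≤ ord_p #Ш(E/K) + ord_p ∏c(E) + ord_p ∏c(Wd) +
2·ord_p c(Dt)`, granted finiteness of `Ш(E/K)`. CONCLUSION: `ord_p #Ш(E)_an ≤ ord_p #Ш(E)`
(`Typed.MissingLowerBoundAt W p`) on all those pairs, every odd `p`. Nothing is booked; the crux stays OPEN.
[cite: JetchevSkinnerWan2017, §7.4.1 (pp. 29–31)] [cite: Kato2004Asterisque, Thm. 14.5 (3) (p. 236)]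
[cite: Darmon2004, Thm. 3.6 and §3.7] [cite: Miller2011LMS, Def. 1.1] -/
theorem cellGordTwo_missingLowerBoundAt_rankOne_of_towerSurj_of_adjustedIndexBound
    (hGZ : ∀ (N : ℕ) [NeZero N] (W : WeierstrassCurve ℚ) (K : Type) [Field K] [NumberField K],
      gross_zagier N W K)
    (hKo : ∀ (N : ℕ) [NeZero N] (W : WeierstrassCurve ℚ) (K : Type) [Field K] [NumberField K],
      kolyvagin N W K)
    (hKatoT : Kato2004.rankZero_padicValNat_sha_add_padicValNat_tamagawa_le_of_additive_potGood_of_imageContainsSL2)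
    (hGZK : rank_eq_analyticRank_of_analyticRank_le_one) (hmod : hasEntireLFunction_rat)
    (hnf : exists_isNewformOf) (hmodP : nonempty_modularParametrizationData)
    (hFH : friedbergHoffstein_exists_heegnerField_split_twist_ne_zero)
    (hL' : ∀ (W : WeierstrassCurve ℚ) [W.IsElliptic] [W.IsGloballyMinimal] (p : ℕ) [Fact p.Prime]
      (N : ℕ) [NeZero N] (K : Type) [Field K] [NumberField K]
      (Dt : ModularParametrizationData W N) (H : HeegnerDatum N (NumberField.discr K)) (ι : K →+* ℂ)
      (P : (W.baseChange K).toAffine.Point)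
      (Wd : WeierstrassCurve ℚ) [Wd.IsElliptic] [Wd.IsGloballyMinimal] (Cd : VariableChange ℚ),
      W.analyticRank = 1 → N10.CellGordTwo W p → (∀ n : ℕ, W.HasSurjectiveModNGaloisRep (p ^ n : ℕ)) →
      W.conductorNorm ℤ = N → IsImaginaryQuadratic K → SatisfiesHeegnerHypothesis N K →
      WeierstrassCurve.Affine.Point.map ι.toRatAlgHom P = heegnerPointComplex Dt H →
      Cd • W.quadraticTwist (NumberField.discr K : ℚ) = Wd →
      Finite (W.baseChange K).sha →
      (2 * padicValNat p (AddSubgroup.zmultiples P).index : ℤ) ≤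
        padicValNat p (W.baseChange K).shaOrder + padicValNat p W.tamagawaProduct +
          padicValNat p Wd.tamagawaProduct + 2 * padicValRat p (Dt.c : ℚ)) :
    ∀ (W : WeierstrassCurve ℚ) [W.IsElliptic] [W.IsGloballyMinimal] (p : ℕ) [Fact p.Prime],
      W.analyticRank = 1 → N10.CellGordTwo W p →
      (∀ n : ℕ, W.HasSurjectiveModNGaloisRep (p ^ n : ℕ)) → Typed.MissingLowerBoundAt W p := by
  intro W _ _ p _ hr hc2 hsurj
  have hp : p.Prime := Fact.out
  obtain ⟨hp2, hadd, hG, he⟩ := hc2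
  haveI : NeZero (W.conductorNorm ℤ) := ⟨(W.conductorNorm_pos_holds).ne'⟩
  have hj : 0 ≤ padicValRat p W.j := not_lt.mp (N10.not_potMult_of_typeGOrd W p hp2 hadd hG)
  have hw : W.rootNumber = -1 := by
    rw [WeierstrassCurve.rootNumber_eq_neg_one_pow_analyticRank_of_exists_isNewformOf hnf W, hr]
    norm_num
  obtain ⟨K, _, _, hK, hdisc, hHN, -, hLt⟩ := hFH W hw p hp 4
  have hμ : ¬ p ∣ Units.torsionOrder K := by
    haveI : IsTotallyComplex K := hK.2
    have hneg : NumberField.discr K < 0 := discr_neg_of_finrank_eq_two K hK.1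
    have habs : ((NumberField.discr K).natAbs : ℤ) = -NumberField.discr K :=
      Int.ofNat_natAbs_of_nonpos hneg.le
    have h4 : NumberField.discr K < -4 := by
      have : (4 : ℤ) < ((NumberField.discr K).natAbs : ℤ) := by exact_mod_cast hdisc
      omega
    rw [Literature.NumberTheory.DiophantineGeometry.torsionOrder_eq_two_of_discr_lt hK.1 h4]
    intro h2
    have := Nat.le_of_dvd two_pos h2
    have h2le : 2 ≤ p := hp.two_le
    omega
  obtain ⟨Dt⟩ := hmodP W
  obtain ⟨β, hβ⟩ := exists_dvd_sq_sub_discr_holds (W.conductorNorm ℤ) K hK hHN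
  obtain ⟨H, -⟩ := nonempty_heegnerDatum_holds (W.conductorNorm ℤ) K hK hβ
  obtain ⟨ι⟩ : Nonempty (K →+* ℂ) := inferInstance
  obtain ⟨P, hP⟩ := heegnerPointComplex_mem_range_map_holds (W.conductorNorm ℤ) W K hK hHN Dt H ι
  have hD0 : (NumberField.discr K : ℚ) ≠ 0 := by exact_mod_cast NumberField.discr_ne_zero K
  haveI hEt : (W.quadraticTwist (NumberField.discr K : ℚ)).IsElliptic :=
    W.isElliptic_quadraticTwist hD0
  obtain ⟨Cd, hCd⟩ := hasGlobalMinimalModel_rat_holds (W.quadraticTwist (NumberField.discr K : ℚ))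
  haveI : (Cd • W.quadraticTwist (NumberField.discr K : ℚ)).IsGloballyMinimal := hCd
  have hWd : Cd • W.quadraticTwist (NumberField.discr K : ℚ) =
      Cd • W.quadraticTwist (NumberField.discr K : ℚ) := rfl
  exact missingLowerBoundAt_rankOne_additive_of_adjustedIndexBound W p K Dt H ι P (hGZ _ W K) (hKo _ W K)
    hKatoT hGZK hmod hr hp2 hadd hj hsurj hK hHN hP hμ hLt
    (Cd • W.quadraticTwist (NumberField.discr K : ℚ)) Cd hWd
    (hL' W p _ K Dt H ι P (Cd • W.quadraticTwist (NumberField.discr K : ℚ)) Cd hr ⟨hp2, hadd, hG, he⟩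
      hsurj rfl hK hHN hP hWd)

/-! ### §16 The crux BY NAME on the adjusted bound -/

/-- **The crux `GordTwoRankOne` BY NAME from the road's BSD-consistent input, with the complementary rows
displayed** — Part 3's `gordTwoRankOne_of_indexLowerBoundAt_of_rest` with `hL` replaced by the adjusted
bound `hL'` (a weaker, BSD-consistent hypothesis): PUBLISHED binders (`hGZ`, `hKo`, `hKatoT`, `hGZK`,
`hmod`, `hnf`, `hmodP`, `hFH`, `hLLT`) + `hL'` on the TOWER-SURJECTIVE rows, Li–Liu–Tian 2024 (`hLLT`, lane
A's `gordTwoRankOne_cm_of_liLiuTian`) on the CM rows, and the crux DISPLAYED on the remaining rows (`hRest`: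
non-CM, non-tower-surjective — X3♯ / O8). An honest split, not a closure; nothing booked; the item stays
OPEN. [cite: JetchevSkinnerWan2017, §7.4.1 (pp. 29–31)] [cite: LiLiuTian2024, Thm. 1.1 (i)]
[cite: Miller2011LMS, Def. 1.1] -/
theorem gordTwoRankOne_of_adjustedIndexBound_of_rest
    (hGZ : ∀ (N : ℕ) [NeZero N] (W : WeierstrassCurve ℚ) (K : Type) [Field K] [NumberField K],
      gross_zagier N W K)
    (hKo : ∀ (N : ℕ) [NeZero N] (W : WeierstrassCurve ℚ) (K : Type) [Field K] [NumberField K],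
      kolyvagin N W K)
    (hKatoT : Kato2004.rankZero_padicValNat_sha_add_padicValNat_tamagawa_le_of_additive_potGood_of_imageContainsSL2)
    (hGZK : rank_eq_analyticRank_of_analyticRank_le_one) (hmod : hasEntireLFunction_rat)
    (hnf : exists_isNewformOf) (hmodP : nonempty_modularParametrizationData)
    (hFH : friedbergHoffstein_exists_heegnerField_split_twist_ne_zero)
    (hLLT : LiLiuTian2024.thm11_bsdp_of_cm_rank_one)
    (hL' : ∀ (W : WeierstrassCurve ℚ) [W.IsElliptic] [W.IsGloballyMinimal] (p : ℕ) [Fact p.Prime]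
      (N : ℕ) [NeZero N] (K : Type) [Field K] [NumberField K]
      (Dt : ModularParametrizationData W N) (H : HeegnerDatum N (NumberField.discr K)) (ι : K →+* ℂ)
      (P : (W.baseChange K).toAffine.Point)
      (Wd : WeierstrassCurve ℚ) [Wd.IsElliptic] [Wd.IsGloballyMinimal] (Cd : VariableChange ℚ),
      W.analyticRank = 1 → N10.CellGordTwo W p → (∀ n : ℕ, W.HasSurjectiveModNGaloisRep (p ^ n : ℕ)) →
      W.conductorNorm ℤ = N → IsImaginaryQuadratic K → SatisfiesHeegnerHypothesis N K →
      WeierstrassCurve.Affine.Point.map ι.toRatAlgHom P = heegnerPointComplex Dt H →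
      Cd • W.quadraticTwist (NumberField.discr K : ℚ) = Wd →
      Finite (W.baseChange K).sha →
      (2 * padicValNat p (AddSubgroup.zmultiples P).index : ℤ) ≤
        padicValNat p (W.baseChange K).shaOrder + padicValNat p W.tamagawaProduct +
          padicValNat p Wd.tamagawaProduct + 2 * padicValRat p (Dt.c : ℚ))
    (hRest : ∀ (W : WeierstrassCurve ℚ) [W.IsElliptic] [W.IsGloballyMinimal] (p : ℕ) [Fact p.Prime],
      W.analyticRank = 1 → N10.CellGordTwo W p → ¬ W.HasCM →
      ¬ (∀ n : ℕ, W.HasSurjectiveModNGaloisRep (p ^ n : ℕ)) → Typed.MissingLowerBoundAt W p) :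
    Summit.BirchSwinnertonDyer.BirchSwinnertonDyer.Theses.AdditiveBranchIMC.GordTwoRankOne := by
  intro W _ _ p _ hr hc2
  by_cases hcm : W.HasCM
  · exact gordTwoRankOne_cm_of_liLiuTian hLLT W p hr hc2 hcm
  by_cases hsurj : ∀ n : ℕ, W.HasSurjectiveModNGaloisRep (p ^ n : ℕ)
  · exact cellGordTwo_missingLowerBoundAt_rankOne_of_towerSurj_of_adjustedIndexBound hGZ hKo hKatoT hGZK
      hmod hnf hmodP hFH hL' W p hr hc2 hsurj
  · exact hRest W p hr hc2 hcm hsurj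

end Summit.BirchSwinnertonDyer.BirchSwinnertonDyer.Theorems.AdditiveBranchIMCGordTwoRankOne.HeegnerKolyvagin

end
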